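import Summits.AnomalousDissipation.AnomalousDissipation.Theorems.SawtoothPulseCascadeK1LocalisedCascadeSmoothStepData
import Summits.AnomalousDissipation.AnomalousDissipation.Theorems.SawtoothPulseCascadeK1LocalisedCascadeLeibnizScale

/-!
# K1loc, line `Spectral` / SeqCone — helper: FIBRE PROFILES ARE LOCALLY AFFINE SMOOTH STEPS (S-B Taylor data, tools)

Helper file of the prover lane on the crux `K1LocalisedCascade` (stmt-AnomalousDissipation-19491), route
`SawtoothPulseCascade` (memo v6 §2 / addendum §C "V-fibre Taylor data"; glue seat k1loc-p3).  The fibre restrictions of the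
concrete lattice symbols of `…SymbolLattice` (additive transition widths) are built from factors
`t ↦ sT((γ|n′ + γ′t| − a₂|t| − κ)/w)` (`sT = Real.smoothTransition`).  Near every point such a factor coincides with an
AFFINE smooth step `t ↦ sT(p + q t)` with `|q| ≤ (|γγ′| + |a₂|)/w` — where the inner absolute values would kink, the
argument is negative and the factor vanishes identically (`smoothStep_cone_locally_affine`).  Consequently all fibre
profiles are smooth and their derivatives obey scale-`b` bounds `|∂ᵗʳ| ≤ C_r/bʳ` with `C_r` depending on `r` alone, as soon
as `|q|·b ≤ 1` for every factor.  This file proves the tools: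
* `iteratedDeriv_smoothTransition_linear`, `abs_iteratedDeriv_smoothTransition_linear_le` — `|(sT(p + q·))⁽ⁿ⁾| ≤ C_n|q|ⁿ ≤ C_n/bⁿ`;
* `smoothStep_cone_locally_affine` (+ the literal corollaries `radial_locally_affine`, `coneStep_locally_affine_add/_sub`,
  `slab_locally_affine`);
* `exists_bound_iteratedDeriv_oneSubMulOneSubMul` — the class computation for the shape
  `1 − sT(p₁ + q₁t)·(1 − sT(p₂ + q₂t)·sT(p₃ + q₃t))` common to all four profiles (via `…LeibnizScale`);
* `abs_iteratedDeriv_sq_le_of_scale` — squares.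
No definitions; no statement about the stub.  [cite: Grafakos2014, Prop. 3.1.2 (5)] [problem: turb]
-/

-- `Summit.<Summit>.<Problem>`: single-conjunct summit, the duplicate namespace segment is deliberate.
set_option linter.dupNamespace false

noncomputable section

namespace Summit.AnomalousDissipation.AnomalousDissipation.Theorems.SawtoothPulseCascade.K1Cutoff

open Set Filter Topology Real
open scoped ContDiff

/-! ## Affine smooth steps `t ↦ sT(p + q t)` -/

/-- `t ↦ sT(p + q t)` is smooth. [folklore] -/
theorem contDiff_smoothTransition_linear (p q : ℝ) {n : ℕ∞} :
    ContDiff ℝ n (fun t => smoothTransition (p + q * t)) :=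
  Real.smoothTransition.contDiff.comp (contDiff_const.add (contDiff_const.mul contDiff_id))

/-- `(sT(p + q·))⁽ⁿ⁾(t) = qⁿ·sT⁽ⁿ⁾(p + q t)`. [folklore] -/
theorem iteratedDeriv_smoothTransition_linear (n : ℕ) (p q t : ℝ) :
    iteratedDeriv n (fun t => smoothTransition (p + q * t)) t = q ^ n * iteratedDeriv n smoothTransition (p + q * t) := by
  have h1 : (fun t => smoothTransition (p + q * t)) = fun t => (fun s => smoothTransition (p + s)) (q * t) := rfl
  have h2 : ContDiff ℝ n (fun s => smoothTransition (p + s)) :=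
    (Real.smoothTransition.contDiff (n := n)).comp (contDiff_const.add contDiff_id)
  rw [h1, iteratedDeriv_comp_const_mul h2 q]
  simp only [iteratedDeriv_comp_const_add n smoothTransition p]

/-- **Scale-`b` bound for an affine smooth step**: `|(sT(p + q·))⁽ⁿ⁾| ≤ C_n/bⁿ` when `|q|·b ≤ 1` (`b > 0`), for any bound
`C_n` of `|sT⁽ⁿ⁾|`. [folklore] -/
theorem abs_iteratedDeriv_smoothTransition_linear_le {n : ℕ} {C : ℝ} (hC : ∀ x, |iteratedDeriv n smoothTransition x| ≤ C)
    {b : ℝ} (hb : 0 < b) {p q : ℝ} (hq : |q| * b ≤ 1) (t : ℝ) :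
    |iteratedDeriv n (fun t => smoothTransition (p + q * t)) t| ≤ C / b ^ n := by
  have hC0 : 0 ≤ C := (abs_nonneg _).trans (hC 0)
  have hqb : |q| ≤ 1 / b := by rwa [le_div_iff₀ hb]
  rw [iteratedDeriv_smoothTransition_linear, abs_mul, abs_pow]
  calc |q| ^ n * |iteratedDeriv n smoothTransition (p + q * t)| ≤ (1 / b) ^ n * C :=
        mul_le_mul (pow_le_pow_left₀ (abs_nonneg _) hqb n) (hC _) (abs_nonneg _) (by positivity)
    _ = C / b ^ n := by rw [one_div, inv_pow]; ring

/-- The same bound with the constant enlarged by one (so that constants `|c| ≤ 1` and complements `1 − sT` fit the same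
class): `|(sT(p + q·))⁽ⁿ⁾| ≤ (C_n + 1)/bⁿ`. [folklore] -/
theorem abs_iteratedDeriv_smoothTransition_linear_le' {n : ℕ} {C : ℝ} (hC : ∀ x, |iteratedDeriv n smoothTransition x| ≤ C)
    {b : ℝ} (hb : 0 < b) {p q : ℝ} (hq : |q| * b ≤ 1) (t : ℝ) :
    |iteratedDeriv n (fun t => smoothTransition (p + q * t)) t| ≤ (C + 1) / b ^ n :=
  (abs_iteratedDeriv_smoothTransition_linear_le hC hb hq t).trans
    (div_le_div_of_nonneg_right (by linarith) (pow_pos hb n).le)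

/-- **Complements**: `|(1 − sT(p + q·))⁽ⁿ⁾| ≤ (C_n + 1)/bⁿ` when `|q|·b ≤ 1`. [folklore] -/
theorem abs_iteratedDeriv_one_sub_smoothTransition_linear_le {n : ℕ} {C : ℝ}
    (hC : ∀ x, |iteratedDeriv n smoothTransition x| ≤ C) {b : ℝ} (hb : 0 < b) {p q : ℝ} (hq : |q| * b ≤ 1) (t : ℝ) :
    |iteratedDeriv n (fun t => 1 - smoothTransition (p + q * t)) t| ≤ (C + 1) / b ^ n := by
  have hC0 : 0 ≤ C := (abs_nonneg _).trans (hC 0)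
  rcases Nat.eq_zero_or_pos n with rfl | hn
  · rw [iteratedDeriv_zero, pow_zero, div_one]
    have h0 := Real.smoothTransition.nonneg (p + q * t)
    have h1 := Real.smoothTransition.le_one (p + q * t)
    rw [abs_le]; constructor <;> linarith
  · rw [iteratedDeriv_const_sub hn, iteratedDeriv_neg, abs_neg]
    exact abs_iteratedDeriv_smoothTransition_linear_le' hC hb hq t

/-! ## The cone-type factors are locally affine smooth steps -/

/-- If `s = ±1` and `0 < s·u` then `|u| = s·u`. [folklore] -/
theorem abs_eq_sign_mul {s u : ℝ} (hs : s = 1 ∨ s = -1) (h : 0 < s * u) : |u| = s * u := by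
  rcases hs with rfl | rfl
  · rw [one_mul] at h ⊢; exact abs_of_pos h
  · rw [neg_one_mul] at h ⊢; exact abs_of_neg (by linarith)

/-- **The cone-type smooth step is locally an affine smooth step.**  Let `f(t) = sT((γ|n′ + γ′t| − a₂|t| − κ)/w)` with
`w > 0`, where either `a₂ = 0` or `x ≠ 0`, and where at a zero of `n′ + γ′·` at `x` the remaining argument is negative
(`n′ + γ′x = 0 ⇒ 0 < a₂|x| + κ`).  Then near `x`, `f` coincides with `t ↦ sT(p + q t)` for some `p, q` with
`|q| ≤ (|γγ′| + |a₂|)/w`.  (At a kink of the inner absolute values the argument is `< 0`, so `f ≡ 0 = sT(0 + 0·t)` there.)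
[folklore] -/
theorem smoothStep_cone_locally_affine {γ γ' a₂ κ w n' x : ℝ} (hw : 0 < w) (hx : a₂ = 0 ∨ x ≠ 0)
    (hdeg : n' + γ' * x = 0 → 0 < a₂ * |x| + κ) :
    ∃ p q : ℝ, |q| ≤ (|γ * γ'| + |a₂|) / w ∧
      (fun t => smoothTransition ((γ * |n' + γ' * t| - a₂ * |t| - κ) / w)) =ᶠ[𝓝 x]
        fun t => smoothTransition (p + q * t) := by
  by_cases hu : n' + γ' * x = 0
  · -- degenerate point: the factor vanishes identically near `x`
    have hlt : γ * |n' + γ' * x| - a₂ * |x| - κ < 0 := by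
      rw [hu, abs_zero, mul_zero, zero_sub]; linarith [hdeg hu]
    have hcont : Continuous fun t => γ * |n' + γ' * t| - a₂ * |t| - κ := by fun_prop
    have hev : ∀ᶠ t in 𝓝 x, γ * |n' + γ' * t| - a₂ * |t| - κ < 0 :=
      hcont.continuousAt.eventually_lt continuousAt_const hlt
    refine ⟨0, 0, by rw [abs_zero]; positivity, ?_⟩
    filter_upwards [hev] with t ht
    rw [zero_mul, add_zero, Real.smoothTransition.zero,
      Real.smoothTransition.zero_of_nonpos (div_nonpos_of_nonpos_of_nonneg ht.le hw.le)]
  · -- generic point: the signs of `n′ + γ′t` and (if needed) of `t` are locally constant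
    obtain ⟨s, hs, hsu⟩ : ∃ s : ℝ, (s = 1 ∨ s = -1) ∧ 0 < s * (n' + γ' * x) := by
      rcases lt_or_gt_of_ne hu with h | h
      · exact ⟨-1, Or.inr rfl, by linarith⟩
      · exact ⟨1, Or.inl rfl, by linarith⟩
    have hs1 : |s| = 1 := by rcases hs with rfl | rfl <;> simp
    have hev₁ : ∀ᶠ t in 𝓝 x, 0 < s * (n' + γ' * t) :=
      continuousAt_const.eventually_lt (by fun_prop : Continuous fun t => s * (n' + γ' * t)).continuousAt hsu
    rcases hx with ha | hx0
    · -- no `|t|` term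
      subst ha
      refine ⟨(γ * s * n' - κ) / w, γ * γ' * s / w, ?_, ?_⟩
      · rw [abs_div, abs_of_pos hw, abs_mul, hs1, mul_one, abs_zero, add_zero]
      · filter_upwards [hev₁] with t ht
        rw [abs_eq_sign_mul hs ht, zero_mul, sub_zero]
        congr 1
        field_simp
        ring
    · obtain ⟨s₀, hs₀, hs₀x⟩ : ∃ s₀ : ℝ, (s₀ = 1 ∨ s₀ = -1) ∧ 0 < s₀ * x := by
        rcases lt_or_gt_of_ne hx0 with h | h
        · exact ⟨-1, Or.inr rfl, by linarith⟩
        · exact ⟨1, Or.inl rfl, by linarith⟩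
      have hs₀1 : |s₀| = 1 := by rcases hs₀ with rfl | rfl <;> simp
      have hev₀ : ∀ᶠ t in 𝓝 x, 0 < s₀ * t :=
        continuousAt_const.eventually_lt (by fun_prop : Continuous fun t => s₀ * t).continuousAt hs₀x
      refine ⟨(γ * s * n' - κ) / w, (γ * γ' * s - a₂ * s₀) / w, ?_, ?_⟩
      · rw [abs_div, abs_of_pos hw]
        refine div_le_div_of_nonneg_right ((abs_sub _ _).trans ?_) hw.le
        rw [abs_mul, hs1, mul_one, abs_mul (a₂), hs₀1, mul_one]
      · filter_upwards [hev₁, hev₀] with t ht ht₀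
        rw [abs_eq_sign_mul hs ht, abs_eq_sign_mul hs₀ ht₀]
        congr 1
        field_simp
        ring

/-- **Radial factor**: near every `x`, `sT((|t| − L)/(εL))` is an affine smooth step with `|q| ≤ 1/(εL)` (`ε, L > 0`;
around `0` the factor vanishes identically). [folklore] -/
theorem radial_locally_affine {ε L : ℝ} (hε : 0 < ε) (hL : 0 < L) (x : ℝ) :
    ∃ p q : ℝ, |q| ≤ 1 / (ε * L) ∧
      (fun t => smoothTransition ((|t| - L) / (ε * L))) =ᶠ[𝓝 x] fun t => smoothTransition (p + q * t) := by
  obtain ⟨p, q, hq, h⟩ := smoothStep_cone_locally_affine (γ := 1) (γ' := 1) (a₂ := 0) (κ := L) (n' := 0) (x := x)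
    (mul_pos hε hL) (Or.inl rfl) (fun _ => by rw [zero_mul, zero_add]; exact hL)
  refine ⟨p, q, by simpa using hq, ?_⟩
  refine EventuallyEq.trans (Eventually.of_forall fun t => ?_) h
  simp

/-- **Cone factor, `+` branch**: near `x ≠ 0`, `sT((γ|n′ + γt| − a₂|t|)/w)` is an affine smooth step with
`|q| ≤ (γ² + a₂)/w` (`w, a₂ > 0`). [folklore] -/
theorem coneStep_locally_affine_add {γ a₂ w n' x : ℝ} (hw : 0 < w) (ha₂ : 0 < a₂) (hx : x ≠ 0) :
    ∃ p q : ℝ, |q| ≤ (γ ^ 2 + a₂) / w ∧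
      (fun t => smoothTransition ((γ * |n' + γ * t| - a₂ * |t|) / w)) =ᶠ[𝓝 x]
        fun t => smoothTransition (p + q * t) := by
  obtain ⟨p, q, hq, h⟩ := smoothStep_cone_locally_affine (γ := γ) (γ' := γ) (a₂ := a₂) (κ := 0) (n' := n') (x := x)
    hw (Or.inr hx) (fun _ => by rw [add_zero]; exact mul_pos ha₂ (abs_pos.mpr hx))
  refine ⟨p, q, ?_, ?_⟩
  · rwa [abs_mul_self, abs_of_pos ha₂, ← pow_two] at hq
  · refine EventuallyEq.trans (Eventually.of_forall fun t => ?_) h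
    simp only [sub_zero]

/-- **Cone factor, `−` branch**: near `x ≠ 0`, `sT((γ|n′ − γt| − a₂|t|)/w)` is an affine smooth step with
`|q| ≤ (γ² + a₂)/w` (`w, a₂ > 0`). [folklore] -/
theorem coneStep_locally_affine_sub {γ a₂ w n' x : ℝ} (hw : 0 < w) (ha₂ : 0 < a₂) (hx : x ≠ 0) :
    ∃ p q : ℝ, |q| ≤ (γ ^ 2 + a₂) / w ∧
      (fun t => smoothTransition ((γ * |n' - γ * t| - a₂ * |t|) / w)) =ᶠ[𝓝 x]
        fun t => smoothTransition (p + q * t) := by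
  obtain ⟨p, q, hq, h⟩ := smoothStep_cone_locally_affine (γ := γ) (γ' := -γ) (a₂ := a₂) (κ := 0) (n' := n') (x := x)
    hw (Or.inr hx) (fun _ => by rw [add_zero]; exact mul_pos ha₂ (abs_pos.mpr hx))
  refine ⟨p, q, ?_, ?_⟩
  · rwa [mul_neg, abs_neg, abs_mul_self, abs_of_pos ha₂, ← pow_two] at hq
  · refine EventuallyEq.trans (Eventually.of_forall fun t => ?_) h
    simp only [neg_mul, ← sub_eq_add_neg, sub_zero]

/-- **Translated cone factor with constant offset** (H-fibre shape): near ANY `x`, `sT((γ|t − t₀| − κ)/w)` is an affine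
smooth step with `|q| ≤ |γ|/w` (`w, κ > 0`; the profile is locally `0` around `t₀`). [folklore] -/
theorem shiftStep_locally_affine {γ κ w t₀ x : ℝ} (hw : 0 < w) (hκ : 0 < κ) :
    ∃ p q : ℝ, |q| ≤ |γ| / w ∧
      (fun t => smoothTransition ((γ * |t - t₀| - κ) / w)) =ᶠ[𝓝 x] fun t => smoothTransition (p + q * t) := by
  obtain ⟨p, q, hq, h⟩ := smoothStep_cone_locally_affine (γ := γ) (γ' := 1) (a₂ := 0) (κ := κ) (n' := -t₀) (x := x)
    hw (Or.inl rfl) (fun _ => by rw [zero_mul, zero_add]; exact hκ)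
  refine ⟨p, q, by simpa using hq, ?_⟩
  refine EventuallyEq.trans (Eventually.of_forall fun t => ?_) h
  simp only [one_mul, zero_mul, sub_zero, neg_add_eq_sub]

/-- **Slab factor** (new start-of-phase symbol along a V-fibre): near `x ≠ 0`, `sT((κ − a|t|)/w)` is an affine smooth step
with `|q| ≤ |a|/w` (`w > 0`). [folklore] -/
theorem slab_locally_affine {a κ w x : ℝ} (hw : 0 < w) (hx : x ≠ 0) :
    ∃ p q : ℝ, |q| ≤ |a| / w ∧
      (fun t => smoothTransition ((κ - a * |t|) / w)) =ᶠ[𝓝 x] fun t => smoothTransition (p + q * t) := by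
  obtain ⟨p, q, hq, h⟩ := smoothStep_cone_locally_affine (γ := 0) (γ' := 0) (a₂ := a) (κ := -κ) (n' := 1) (x := x)
    hw (Or.inr hx) (fun h => by norm_num at h)
  refine ⟨p, q, by simpa using hq, ?_⟩
  refine EventuallyEq.trans (Eventually.of_forall fun t => ?_) h
  simp only [zero_mul, zero_sub, sub_neg_eq_add]
  ring_nf

/-! ## The class computation for `1 − F₁·(1 − F₂·F₃)` and for squares -/

/-- **All-orders scale-`b` bounds for `t ↦ 1 − sT(p₁ + q₁t)·(1 − sT(p₂ + q₂t)·sT(p₃ + q₃t))`**: for every order `r`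
there is `C_r ≥ 0` (depending on `r` only) with `|∂ʳ(…)(t)| ≤ C_r/bʳ` whenever `b > 0` and `|qᵢ|·b ≤ 1` (`i = 1,2,3`).
[cite: Grafakos2014, Prop. 3.1.2 (5)] -/
theorem exists_bound_iteratedDeriv_oneSubMulOneSubMul (r : ℕ) :
    ∃ C : ℝ, 0 ≤ C ∧ ∀ {b p₁ q₁ p₂ q₂ p₃ q₃ : ℝ}, 0 < b → |q₁| * b ≤ 1 → |q₂| * b ≤ 1 → |q₃| * b ≤ 1 → ∀ t : ℝ,
      |iteratedDeriv r (fun t => 1 - smoothTransition (p₁ + q₁ * t) *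
        (1 - smoothTransition (p₂ + q₂ * t) * smoothTransition (p₃ + q₃ * t))) t| ≤ C / b ^ r := by
  choose Cst hCst0 hCst using exists_bound_iteratedDeriv_smoothTransition
  -- class constants: factors `K`, product `K2`, `F₁·(1 − F₂F₃)` `K3`
  set K : ℕ → ℝ := fun n => Cst n + 1 with hK
  set K2 : ℕ → ℝ := fun n => ∑ i ∈ Finset.range (n + 1), (n.choose i : ℝ) * K i * K (n - i) with hK2
  set K3 : ℕ → ℝ := fun n => ∑ i ∈ Finset.range (n + 1), (n.choose i : ℝ) * K i * (K2 (n - i) + 1) with hK3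
  have hK0 : ∀ n, 0 ≤ K n := fun n => by rw [hK]; linarith [hCst0 n]
  have hK20 : ∀ n, 0 ≤ K2 n := fun n => Finset.sum_nonneg fun i _ => by
    have := hK0 i; have := hK0 (n - i); positivity
  have hK30 : ∀ n, 0 ≤ K3 n := fun n => Finset.sum_nonneg fun i _ => by
    have := hK0 i; have := hK20 (n - i); positivity
  refine ⟨K3 r + 1, by linarith [hK30 r], ?_⟩
  intro b p₁ q₁ p₂ q₂ p₃ q₃ hb hq₁ hq₂ hq₃ t
  -- factor bounds
  have hF : ∀ {p q : ℝ}, |q| * b ≤ 1 → ∀ i (x : ℝ), |iteratedDeriv i (fun t => smoothTransition (p + q * t)) x| ≤ K i / b ^ i :=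
    fun hq i x => abs_iteratedDeriv_smoothTransition_linear_le' (hCst i) hb hq x
  have hsm : ∀ p q : ℝ, ContDiff ℝ ∞ (fun t => smoothTransition (p + q * t)) := fun p q => contDiff_smoothTransition_linear p q
  -- `F₂F₃`
  have h23 : ∀ n (x : ℝ), |iteratedDeriv n (fun t => smoothTransition (p₂ + q₂ * t) * smoothTransition (p₃ + q₃ * t)) x| ≤
      K2 n / b ^ n := fun n x =>
    abs_iteratedDeriv_mul_le_of_scale (hsm p₂ q₂) (hsm p₃ q₃) hb (fun i _ x => hF hq₂ i x) (fun i _ x => hF hq₃ i x) x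
  -- `1 − F₂F₃`
  have hsm23 : ContDiff ℝ ∞ (fun t => 1 - smoothTransition (p₂ + q₂ * t) * smoothTransition (p₃ + q₃ * t)) :=
    contDiff_const.sub ((hsm p₂ q₂).mul (hsm p₃ q₃))
  have h23' : ∀ n (x : ℝ), |iteratedDeriv n (fun t => 1 - smoothTransition (p₂ + q₂ * t) * smoothTransition (p₃ + q₃ * t)) x| ≤
      (K2 n + 1) / b ^ n := by
    intro n x
    rcases Nat.eq_zero_or_pos n with rfl | hn
    · rw [iteratedDeriv_zero, pow_zero, div_one]
      have h := h23 0 x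
      rw [iteratedDeriv_zero, pow_zero, div_one] at h
      calc |1 - smoothTransition (p₂ + q₂ * x) * smoothTransition (p₃ + q₃ * x)|
          ≤ |(1 : ℝ)| + |smoothTransition (p₂ + q₂ * x) * smoothTransition (p₃ + q₃ * x)| := abs_sub _ _
        _ ≤ K2 0 + 1 := by rw [abs_one]; linarith
    · rw [iteratedDeriv_const_sub hn, iteratedDeriv_neg, abs_neg]
      exact (h23 n x).trans (div_le_div_of_nonneg_right (by linarith) (pow_pos hb n).le)
  -- `F₁·(1 − F₂F₃)`
  have h123 : ∀ n (x : ℝ), |iteratedDeriv n (fun t => smoothTransition (p₁ + q₁ * t) *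
      (1 - smoothTransition (p₂ + q₂ * t) * smoothTransition (p₃ + q₃ * t))) x| ≤ K3 n / b ^ n := fun n x =>
    abs_iteratedDeriv_mul_le_of_scale (hsm p₁ q₁) hsm23 hb (fun i _ x => hF hq₁ i x) (fun i _ x => h23' i x) x
  -- `1 − F₁·(1 − F₂F₃)`
  rcases Nat.eq_zero_or_pos r with hr | hr
  · subst hr
    rw [iteratedDeriv_zero, pow_zero, div_one]
    have h := h123 0 t
    rw [iteratedDeriv_zero, pow_zero, div_one] at h
    calc |1 - smoothTransition (p₁ + q₁ * t) * (1 - smoothTransition (p₂ + q₂ * t) * smoothTransition (p₃ + q₃ * t))|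
        ≤ |(1 : ℝ)| + |smoothTransition (p₁ + q₁ * t) *
            (1 - smoothTransition (p₂ + q₂ * t) * smoothTransition (p₃ + q₃ * t))| := abs_sub _ _
      _ ≤ K3 0 + 1 := by rw [abs_one]; linarith
  · rw [iteratedDeriv_const_sub hr, iteratedDeriv_neg, abs_neg]
    exact (h123 r t).trans (div_le_div_of_nonneg_right (by linarith) (pow_pos hb r).le)

/-- `t ↦ 1 − sT(p₁ + q₁t)·(1 − sT(p₂ + q₂t)·sT(p₃ + q₃t))` is smooth. [folklore] -/
theorem contDiff_oneSubMulOneSubMul (p₁ q₁ p₂ q₂ p₃ q₃ : ℝ) :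
    ContDiff ℝ ∞ (fun t => 1 - smoothTransition (p₁ + q₁ * t) *
      (1 - smoothTransition (p₂ + q₂ * t) * smoothTransition (p₃ + q₃ * t))) :=
  contDiff_const.sub ((contDiff_smoothTransition_linear p₁ q₁).mul
    (contDiff_const.sub ((contDiff_smoothTransition_linear p₂ q₂).mul (contDiff_smoothTransition_linear p₃ q₃))))

/-- **Squares at scale `b`**: if `M` is smooth with `|M⁽ⁱ⁾| ≤ Cᵢ/bⁱ` for `i ≤ n` then
`|(M²)⁽ⁿ⁾| ≤ (Σᵢ C(n,i)CᵢC_{n−i})/bⁿ`. [folklore] -/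
theorem abs_iteratedDeriv_sq_le_of_scale {M : ℝ → ℝ} (hM : ContDiff ℝ ∞ M) {n : ℕ} {b : ℝ} (hb : 0 < b) {C : ℕ → ℝ}
    (hC : ∀ i ≤ n, ∀ x, |iteratedDeriv i M x| ≤ C i / b ^ i) (x : ℝ) :
    |iteratedDeriv n (fun t => M t ^ 2) x| ≤ (∑ i ∈ Finset.range (n + 1), (n.choose i : ℝ) * C i * C (n - i)) / b ^ n := by
  have h := abs_iteratedDeriv_mul_le_of_scale hM hM hb hC hC x
  simpa only [pow_two] using h

end Summit.AnomalousDissipation.AnomalousDissipation.Theorems.SawtoothPulseCascade.K1Cutoff
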